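import Mathlib
import Literature.Computability.AlgebraicComplexity.SetMultilinear

/-!
# SuccinctLift — characteristic-free set-multilinear expansion of a product (`exp`/`log` on the
subset-convolution algebra)

Support file for wall D of `route-ValiantsHypothesis-SuccinctLift` (stmt-ValiantsHypothesis-23721,
census cell W34 «2-non-unit cut»): the ALGEBRA behind Forbes's observation that the
Limaye–Srinivasan–Tavenas set-multilinearisation of low product-depth circuits works over EVERY field
(Forbes, CCC 2024: "set-multilinearization … over any field, by using the Binet–Minc identity").

The set-multilinear parts `S ↦ (f)_S` (`smlProj`) of a polynomial form an element of the commutative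
SUBSET-CONVOLUTION algebra of functions `Finset ι → α`,
`(L ⋆ L')(B) = ∑_{B₁ ⊆ B} L(B₁) L'(B ∖ B₁)` (`conv`), and `f ↦ (f)_•` is multiplicative
(`smlProj_mul`).  This first file sets up set partitions as `Finset (Finset ι)` with a predicate
(`IsPartition`, `parts`, no quotient types) and the combinatorial exponential
`pexp M (B) = ∑_{π ⊢ B} ∏_{Q ∈ π} M Q` (sum over set partitions, INTEGER coefficients, no factorials),
and proves the exponential law `pexp (M₁ + M₂) = pexp M₁ ⋆ pexp M₂` (`pexp_add`, by splitting a
partition of `B` along a subset `B₁`: `isPartition_union_iff`).  The logarithm (`exists_plog`), the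
labelled indexing of partitions and the product-gate expansion over any field follow in
`SuccinctLiftSmlPlog.lean` and `SuccinctLiftSmlProduct.lean`.  No division by integers occurs anywhere,
so everything holds over every commutative ring — the point of Forbes's "over any field" version of
the Limaye–Srinivasan–Tavenas set-multilinearisation.

References: Forbes2024LowDepth (CCC 2024, Thm. 1, §1.2 "via the Binet–Minc identity");
LimayeSrinivasanTavenas2025 (J. ACM 72, Lemma 12, the characteristic-zero set-multilinearisation);
Minc 1978 (Permanents, §2, Binet–Minc formula).
-/

noncomputable section

open MvPolynomial Finset

-- the summit and the problem share the name `ValiantsHypothesis` (D-0017 single-conjunct layout)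
set_option linter.dupNamespace false

namespace Summit.ValiantsHypothesis.ValiantsHypothesis.Theorems.SuccinctLiftSmlConvolution

open Literature.Computability.AlgebraicComplexity

universe u v w

section ConvolutionAlgebra

variable {α : Type u} [CommRing α] {ι : Type w} [DecidableEq ι]

/-! ### The subset-convolution product and set partitions -/

/-- The subset convolution `(L ⋆ L')(B) = ∑_{B₁ ⊆ B} L B₁ · L' (B ∖ B₁)` of two functions on finite
sets of blocks (the product of the algebra `α[z_i]/(z_i²)` in the basis `z^B`).
[cite: LimayeSrinivasanTavenas2025, Lemma 12] -/
def conv (L L' : Finset ι → α) (B : Finset ι) : α := ∑ B₁ ∈ B.powerset, L B₁ * L' (B \ B₁)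

/-- `Pt` is a set partition of `B`: nonempty, pairwise disjoint parts with union `B`. [folklore] -/
structure IsPartition (B : Finset ι) (Pt : Finset (Finset ι)) : Prop where
  /-- parts are nonempty -/
  nonempty : ∀ Q ∈ Pt, Q.Nonempty
  /-- distinct parts are disjoint -/
  disjoint : ∀ Q ∈ Pt, ∀ Q' ∈ Pt, Q ≠ Q' → Disjoint Q Q'
  /-- the parts cover `B` exactly -/
  sup : Pt.biUnion id = B

/-- Parts of a partition of `B` are subsets of `B`. [folklore] -/
theorem IsPartition.subset {B : Finset ι} {Pt : Finset (Finset ι)}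
    (h : IsPartition B Pt) {Q : Finset ι} (hQ : Q ∈ Pt) : Q ⊆ B := by
  rw [← h.sup]; exact Finset.subset_biUnion_of_mem id hQ

/-- The finite set of set partitions of `B`. [folklore] -/
def parts (B : Finset ι) : Finset (Finset (Finset ι)) :=
  open Classical in (B.powerset.powerset).filter (IsPartition B)

/-- Membership in `parts B` is being a set partition of `B`. [folklore] -/
theorem mem_parts {B : Finset ι} {Pt : Finset (Finset ι)} : Pt ∈ parts B ↔ IsPartition B Pt := by
  classical
  unfold parts
  rw [Finset.mem_filter, and_iff_right_iff_imp]
  intro h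
  rw [Finset.mem_powerset]
  intro Q hQ
  rw [Finset.mem_powerset]
  exact h.subset hQ

/-- The only partition of `∅` is the empty family. [folklore] -/
theorem parts_empty : parts (∅ : Finset ι) = {∅} := by
  classical
  ext Pt
  rw [mem_parts, Finset.mem_singleton]
  constructor
  · intro h
    rw [Finset.eq_empty_iff_forall_notMem]
    intro Q hQ
    have h1 := h.subset hQ
    have h2 := h.nonempty Q hQ
    rw [Finset.subset_empty] at h1
    rw [h1] at h2
    exact Finset.not_nonempty_empty h2
  · rintro rfl
    exact ⟨fun Q hQ => by simp at hQ, fun Q hQ => by simp at hQ, by simp⟩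

/-- A partition of a nonempty set is a nonempty family; of `∅`, the empty family. [folklore] -/
theorem IsPartition.eq_empty_iff {B : Finset ι} {Pt : Finset (Finset ι)} (h : IsPartition B Pt) :
    Pt = ∅ ↔ B = ∅ := by
  constructor
  · rintro rfl
    rw [← h.sup]; simp
  · rintro rfl
    have : Pt ∈ parts (∅ : Finset ι) := mem_parts.2 h
    rw [parts_empty, Finset.mem_singleton] at this
    exact this

/-- `{Q}` is a partition of a nonempty `Q`. [folklore] -/
theorem singleton_mem_parts {Q : Finset ι} (hQ : Q.Nonempty) : {Q} ∈ parts Q :=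
  mem_parts.2 ⟨fun Q' h => by rw [Finset.mem_singleton] at h; rw [h]; exact hQ,
    fun Q₁ h₁ Q₂ h₂ hne => by
      rw [Finset.mem_singleton] at h₁ h₂; exact absurd (h₁.trans h₂.symm) hne, by simp⟩

/-- A partition of `Q` containing `Q` itself is `{Q}`. [folklore] -/
theorem IsPartition.eq_singleton {Q : Finset ι} {Pt : Finset (Finset ι)} (h : IsPartition Q Pt)
    (hQ : Q ∈ Pt) : Pt = {Q} := by
  refine Finset.eq_singleton_iff_unique_mem.2 ⟨hQ, fun Q' hQ' => ?_⟩
  by_contra hne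
  have hd := h.disjoint Q' hQ' Q hQ hne
  have hs := h.subset hQ'
  have hn := h.nonempty Q' hQ'
  obtain ⟨x, hx⟩ := hn
  exact Finset.disjoint_left.1 hd hx (hs hx)

/-- In a partition of `Q` other than `{Q}`, every part is strictly smaller than `Q`. [folklore] -/
theorem card_lt_of_mem_parts_erase {Q : Finset ι} {Pt : Finset (Finset ι)}
    (hPt : Pt ∈ (parts Q).erase {Q}) {P : Finset ι} (hP : P ∈ Pt) : P.card < Q.card := by
  rw [Finset.mem_erase, mem_parts] at hPt
  refine Finset.card_lt_card (Finset.ssubset_iff_subset_ne.2 ⟨hPt.2.subset hP, fun hPQ => ?_⟩)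
  rw [hPQ] at hP
  exact hPt.1 (hPt.2.eq_singleton hP)

/-- The combinatorial exponential: `pexp M (B) = ∑_{π ⊢ B} ∏_{Q ∈ π} M Q` (integer coefficients —
no `1/k!`). [cite: Forbes2024LowDepth, §1.2] -/
def pexp (M : Finset ι → α) (B : Finset ι) : α := ∑ Pt ∈ parts B, ∏ Q ∈ Pt, M Q

/-- `pexp M ∅ = 1`. [folklore] -/
@[simp] theorem pexp_empty (M : Finset ι → α) : pexp M ∅ = 1 := by
  rw [pexp, parts_empty, Finset.sum_singleton, Finset.prod_empty]

/-- `pexp 0 = δ_∅`, the unit of the convolution algebra. [folklore] -/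
theorem pexp_zero (B : Finset ι) : pexp (fun _ => (0 : α)) B = if B = ∅ then 1 else 0 := by
  split_ifs with hB
  · rw [hB, pexp_empty]
  · rw [pexp]
    refine Finset.sum_eq_zero fun Pt hPt => ?_
    rw [mem_parts] at hPt
    have hne : Pt.Nonempty := by
      rw [Finset.nonempty_iff_ne_empty, Ne, hPt.eq_empty_iff]; exact hB
    obtain ⟨Q, hQ⟩ := hne
    exact Finset.prod_eq_zero hQ rfl

/-- Splitting off the trivial partition: `pexp M Q = M Q + ∑_{π ⊢ Q, π ≠ {Q}} ∏_{P ∈ π} M P` for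
nonempty `Q` (the triangularity behind `plog`). [folklore] -/
theorem pexp_eq_add_sum_erase (M : Finset ι → α) {Q : Finset ι} (hQ : Q.Nonempty) :
    pexp M Q = M Q + ∑ Pt ∈ (parts Q).erase {Q}, ∏ P ∈ Pt, M P := by
  rw [pexp, ← Finset.add_sum_erase _ _ (singleton_mem_parts hQ), Finset.prod_singleton]

/-! ### `pexp` turns sums into convolution products -/

/-- The two readings of a pair of families `(C, D)`: "`C ⊔ D` is a partition of `B` into two
labelled halves" versus "`C` partitions some `B₁ ⊆ B` and `D` partitions `B ∖ B₁`". [folklore] -/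
theorem isPartition_union_iff {B : Finset ι} {C D : Finset (Finset ι)} :
    (Disjoint C D ∧ IsPartition B (C ∪ D)) ↔
      (C.biUnion id ⊆ B ∧ IsPartition (C.biUnion id) C ∧ IsPartition (B \ C.biUnion id) D) := by
  constructor
  · rintro ⟨hCD, hne, hdis, hun⟩
    have hCB : C.biUnion id ⊆ B := by
      rw [← hun]; exact Finset.biUnion_subset_biUnion_of_subset_left _ Finset.subset_union_left
    refine ⟨hCB, ⟨fun Q hQ => hne Q (Finset.mem_union_left _ hQ), fun Q hQ Q' hQ' h =>
      hdis Q (Finset.mem_union_left _ hQ) Q' (Finset.mem_union_left _ hQ') h, rfl⟩,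
      ⟨fun Q hQ => hne Q (Finset.mem_union_right _ hQ), fun Q hQ Q' hQ' h =>
      hdis Q (Finset.mem_union_right _ hQ) Q' (Finset.mem_union_right _ hQ') h, ?_⟩⟩
    have hdj : Disjoint (C.biUnion id) (D.biUnion id) := by
      rw [Finset.disjoint_biUnion_left]
      intro Q hQ
      rw [Finset.disjoint_biUnion_right]
      intro Q' hQ'
      refine hdis Q (Finset.mem_union_left _ hQ) Q' (Finset.mem_union_right _ hQ') fun h => ?_
      rw [h] at hQ
      exact Finset.disjoint_left.1 hCD hQ hQ'
    rw [← hun, Finset.union_biUnion, Finset.union_sdiff_cancel_left hdj]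
  · rintro ⟨hCB, hC, hD⟩
    have hcross : ∀ Q ∈ C, ∀ Q' ∈ D, Disjoint Q Q' := by
      intro Q hQ Q' hQ'
      have h1 : Q ⊆ C.biUnion id := hC.subset hQ
      have h2 : Q' ⊆ B \ C.biUnion id := hD.subset hQ'
      exact Finset.disjoint_of_subset_left h1
        (Finset.disjoint_of_subset_right h2 Finset.disjoint_sdiff)
    refine ⟨?_, fun Q hQ => ?_, fun Q hQ Q' hQ' hne => ?_, ?_⟩
    · rw [Finset.disjoint_left]
      intro Q hQ hQ'
      have h := hcross Q hQ Q hQ'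
      rw [disjoint_self, Finset.bot_eq_empty] at h
      have := hC.nonempty Q hQ
      rw [h] at this
      exact Finset.not_nonempty_empty this
    · rcases Finset.mem_union.1 hQ with h | h
      · exact hC.nonempty Q h
      · exact hD.nonempty Q h
    · rcases Finset.mem_union.1 hQ with h | h <;> rcases Finset.mem_union.1 hQ' with h' | h'
      · exact hC.disjoint Q h Q' h' hne
      · exact hcross Q h Q' h'
      · exact (hcross Q' h' Q h).symm
      · exact hD.disjoint Q h Q' h' hne
    · rw [Finset.union_biUnion, hC.sup, hD.sup, Finset.union_sdiff_of_subset hCB]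

/-- **`pexp (M₁ + M₂) = pexp M₁ ⋆ pexp M₂`** (the exponential law of the subset-convolution algebra,
with integer coefficients: a partition of `B` with two-coloured blocks is a splitting `B = B₁ ⊔ B₂`
and a partition of each half). [cite: Forbes2024LowDepth, §1.2] -/
theorem pexp_add (M₁ M₂ : Finset ι → α) (B : Finset ι) :
    pexp (fun Q => M₁ Q + M₂ Q) B = conv (pexp M₁) (pexp M₂) B := by
  classical
  -- the universe of families of subsets of `B`
  set Uu : Finset (Finset (Finset ι)) := B.powerset.powerset with hUu
  have hpartsUu : ∀ B₁ ⊆ B, parts B₁ ⊆ Uu := by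
    intro B₁ hB₁ Pt hPt
    rw [mem_parts] at hPt
    rw [hUu, Finset.mem_powerset]
    intro Q hQ
    rw [Finset.mem_powerset]
    exact (hPt.subset hQ).trans hB₁
  have hsubUu : ∀ Pt ∈ Uu, ∀ C ⊆ Pt, C ∈ Uu := by
    intro Pt hPt C hC
    rw [hUu, Finset.mem_powerset] at hPt ⊢
    exact hC.trans hPt
  set g : Finset (Finset ι) → Finset (Finset ι) → α := fun C D => (∏ Q ∈ C, M₁ Q) * ∏ Q ∈ D, M₂ Q
    with hg
  -- both sides equal the indicator sum over pairs `(C, D) ∈ Uu × Uu`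
  have hL : pexp (fun Q => M₁ Q + M₂ Q) B =
      ∑ C ∈ Uu, ∑ D ∈ Uu, if Disjoint C D ∧ IsPartition B (C ∪ D) then g C D else 0 := by
    rw [pexp]
    simp_rw [Finset.prod_add]
    -- `∑_{Pt ⊢ B} ∑_{C ⊆ Pt} g C (Pt \ C)`
    have h1 : ∀ Pt ∈ parts B, (∑ C ∈ Pt.powerset, (∏ Q ∈ C, M₁ Q) * ∏ Q ∈ Pt \ C, M₂ Q) =
        ∑ C ∈ Uu, if C ⊆ Pt then g C (Pt \ C) else 0 := by
      intro Pt hPt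
      rw [← Finset.sum_filter]
      congr 1
      ext C
      rw [Finset.mem_filter, Finset.mem_powerset]
      exact ⟨fun hC => ⟨hsubUu Pt (hpartsUu B Finset.Subset.rfl hPt) C hC, hC⟩, fun h => h.2⟩
    rw [Finset.sum_congr rfl h1, Finset.sum_comm]
    refine Finset.sum_congr rfl fun C hC => ?_
    -- reindex `Pt ↦ Pt \ C`
    rw [← Finset.sum_filter, ← Finset.sum_filter]
    refine Finset.sum_nbij' (fun Pt => Pt \ C) (fun D => C ∪ D) ?_ ?_ ?_ ?_ ?_
    · intro Pt hPt
      rw [Finset.mem_filter] at hPt ⊢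
      refine ⟨hsubUu Pt (hpartsUu B Finset.Subset.rfl hPt.1) _ Finset.sdiff_subset,
        Finset.disjoint_sdiff, ?_⟩
      rw [Finset.union_sdiff_of_subset hPt.2]
      exact mem_parts.1 hPt.1
    · intro D hD
      rw [Finset.mem_filter] at hD ⊢
      exact ⟨mem_parts.2 hD.2.2, Finset.subset_union_left⟩
    · intro Pt hPt
      rw [Finset.mem_filter] at hPt
      exact Finset.union_sdiff_of_subset hPt.2
    · intro D hD
      rw [Finset.mem_filter] at hD
      exact Finset.union_sdiff_cancel_left hD.2.1
    · intro Pt hPt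
      rfl
  have hR : conv (pexp M₁) (pexp M₂) B =
      ∑ C ∈ Uu, ∑ D ∈ Uu, if Disjoint C D ∧ IsPartition B (C ∪ D) then g C D else 0 := by
    rw [conv]
    have h1 : ∀ B₁ ∈ B.powerset, pexp M₁ B₁ * pexp M₂ (B \ B₁) =
        ∑ C ∈ Uu, ∑ D ∈ Uu,
          if IsPartition B₁ C ∧ IsPartition (B \ B₁) D then g C D else 0 := by
      intro B₁ hB₁
      rw [Finset.mem_powerset] at hB₁
      rw [pexp, pexp, Finset.sum_mul_sum]
      rw [← Finset.sum_subset (hpartsUu B₁ hB₁) (fun C _ hC => ?_)]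
      · refine Finset.sum_congr rfl fun C hC => ?_
        rw [← Finset.sum_subset (hpartsUu (B \ B₁) Finset.sdiff_subset) (fun D _ hD => ?_)]
        · refine Finset.sum_congr rfl fun D hD => ?_
          rw [if_pos ⟨mem_parts.1 hC, mem_parts.1 hD⟩]
        · rw [if_neg (fun h => hD (mem_parts.2 h.2))]
      · exact Finset.sum_eq_zero fun D _ => if_neg fun h => hC (mem_parts.2 h.1)
    rw [Finset.sum_congr rfl h1, Finset.sum_comm]
    refine Finset.sum_congr rfl fun C hC => ?_
    rw [Finset.sum_comm]
    refine Finset.sum_congr rfl fun D hD => ?_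
    -- the sum over `B₁` has at most the one nonzero term `B₁ = ⋃ C`
    have h2 : ∀ B₁ ∈ B.powerset, (if IsPartition B₁ C ∧ IsPartition (B \ B₁) D then g C D else 0) =
        if B₁ = C.biUnion id then
          (if C.biUnion id ⊆ B ∧ IsPartition (C.biUnion id) C ∧ IsPartition (B \ C.biUnion id) D
            then g C D else 0) else 0 := by
      intro B₁ hB₁
      rw [Finset.mem_powerset] at hB₁
      by_cases h : B₁ = C.biUnion id
      · rw [if_pos h, ← h]
        by_cases h' : IsPartition B₁ C ∧ IsPartition (B \ B₁) D
        · rw [if_pos h', if_pos ⟨hB₁, h'⟩]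
        · rw [if_neg h', if_neg (fun h'' => h' h''.2)]
      · rw [if_neg h, if_neg]
        rintro ⟨hC', -⟩
        exact h hC'.sup.symm
    rw [Finset.sum_congr rfl h2, Finset.sum_ite_eq']
    by_cases hmem : C.biUnion id ∈ B.powerset
    · rw [if_pos hmem]
      congr 1
      exact propext isPartition_union_iff.symm
    · rw [if_neg hmem, if_neg]
      rintro ⟨-, h⟩
      apply hmem
      rw [Finset.mem_powerset, ← h.sup]
      exact Finset.biUnion_subset_biUnion_of_subset_left _ Finset.subset_union_left
  rw [hL, hR]

end ConvolutionAlgebra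

end Summit.ValiantsHypothesis.ValiantsHypothesis.Theorems.SuccinctLiftSmlConvolution
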